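import Literature.NumberTheory.DiophantineGeometry.WeightedRootHeightLower
import HarnessLib

/-!
# Weil heights of the coordinate functions on the superelliptic curves `r^e = x(1-x)`

[GenEll] = S. Mochizuki, *Arithmetic elliptic curves in general position*, Math. J. Okayama Univ. 52
(2010), Thm. 2.1 and its proof pp. 11–13: direction (ii) ⟹ (i) passes through a cover `Y → ℙ¹`
ramified over `{0, 1, ∞}` and the heights of functions on `Y`. In the abc-iut cell's number-field-only
plan for the route item `Summit.ABC.ABC.Theses.IUTThetaPilot.GenEllTwo` (S6, GENELLTWO-P1ROUTE §2(A),
§3, work package W4) the cover is the superelliptic curve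

  `D_e : r^e = x(1 - x)`  (`e` odd, `e + 3 = 2m`),

and the functions used are polynomials in `x, r, s := 1 - 2x`, e.g. `y := s + r^m`. The plan needs the
SHARP comparisons `h(f(P)) = (deg f / e)·h(x(P)) + O(1)` for these functions ([GenEll] Prop. 1.4 (i),
functoriality of heights, for the maps `f, x : D_e → ℙ¹`). Since all of them have their only pole at
the unique point at infinity of `D_e`, each satisfies a weighted integral relation over `ℤ[x]` and
the comparisons follow from `WeightedRootHeight.lean` / `WeightedRootHeightLower.lean` with no height
machine. Stated CONVENTION-FREE, on elements of an arbitrary number field `K` (a point of `D_e` over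
`K` is just a pair `(x, r) ∈ K²` with `r^e = x(1-x)`), in Mathlib's relative height `logHeight₁ = [K:ℚ]·h`:

* `exists_abs_logHeight₁_root_sub_le` — `r^e = x(1-x)` ⟹ `|e·h_K(r) − 2·h_K(x)| ≤ C·[K:ℚ]`;
* `exists_abs_logHeight₁_ySum_sub_le` — `r^e = x(1-x)`, `e + 3 = 2m`, `y = (1 - 2x) + r^m` ⟹
  `|e·h_K(y) − (e+3)·h_K(x)| ≤ C·[K:ℚ]` (minimal relation `(y - s)^e = (x - x²)^m`).

Constants depend on `e` only. Everything is proved; no definitions, no named facts; classical height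
theory (Bombieri–Gubler §2.5) — nothing here refers to the disputed parts of the abc-iut corpus.
-/

noncomputable section

open Height Finset Polynomial Real

namespace Literature.NumberTheory.DiophantineGeometry

namespace Superelliptic

/-! ### `r^e = x(1-x)`: `e·h(r) = 2·h(x) + O(1)` -/

/-- The weighted relation for `r` over `ℤ[x]`: `r^e + (x² - x) = 0`, i.e. coefficients
`a_0 = X² - X`, `a_k = 0` (`0 < k < e`). [cite: MochizukiGenEll2010, Thm 2.1 proof p.11] -/
private theorem root_rel {K : Type*} [Field K] {e : ℕ} (he : 0 < e) {x r : K}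
    (hr : r ^ e = x * (1 - x)) :
    r ^ e + ∑ k ∈ range e,
      aeval x ((fun k : ℕ => if k = 0 then (X ^ 2 - X : ℤ[X]) else 0) k) * r ^ k = 0 := by
  rw [Finset.sum_eq_single 0]
  · simp only [↓reduceIte, map_sub, map_pow, aeval_X, pow_zero, mul_one, hr]; ring
  · intro k _ hk; simp [hk]
  · intro h; exact absurd (mem_range.mpr he) h

/-- **`r^e = x(1-x)` ⟹ `|e·h(r) − 2·h(x)| ≤ C·[K:ℚ]`** for every number field `K` and `x, r ∈ K`,
with `C` depending only on `e ≥ 1`: the Weil heights of the two coordinate functions of the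
superelliptic curve `D_e` compare with the sharp slope `deg x / deg r = e / 2`
([GenEll] Prop. 1.4 (i) for `x, r : D_e → ℙ¹`; here from the weighted relation `r^e + (x² - x) = 0`,
weights `(wt x, wt r) = (e, 2)`, full weighted degree of the constant term).
[cite: MochizukiGenEll2010, Prop 1.4 (i) p.6] -/
theorem exists_abs_logHeight₁_root_sub_le {e : ℕ} (he : 0 < e) :
    ∃ C : ℝ, ∀ (K : Type) [Field K] [NumberField K] (x r : K), r ^ e = x * (1 - x) →
      |(e : ℝ) * logHeight₁ r - 2 * logHeight₁ x| ≤ C * Module.finrank ℚ K := by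
  set a : ℕ → ℤ[X] := fun k => if k = 0 then X ^ 2 - X else 0 with ha
  have hX2 : (X ^ 2 - X : ℤ[X]).natDegree = 2 := by
    rw [natDegree_sub_eq_left_of_natDegree_lt] <;> simp
  have hd : ∀ k < e, e * (a k).natDegree ≤ 2 * (e - k) := by
    intro k hk
    by_cases hk0 : k = 0
    · subst hk0; simp only [ha, ↓reduceIte, hX2, Nat.sub_zero]; exact le_of_eq (mul_comm _ _)
    · simp [ha, hk0]
  have h0 : e * (a 0).natDegree = 2 * e := by
    simp only [ha, ↓reduceIte, hX2]; exact mul_comm _ _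
  obtain ⟨C, hC⟩ := WeightedRoot.exists_abs_sub_le_of_weighted he he a hd h0
  exact ⟨C, fun K _ _ x r hr => hC K r x (root_rel he hr)⟩

/-! ### `y = s + r^m`, `s = 1 - 2x`, `e + 3 = 2m`: `e·h(y) = (e+3)·h(x) + O(1)` -/

/-- The coefficient polynomials of the minimal relation `(y - (1-2X))^e - (X - X²)^m = 0` of
`y = (1 - 2x) + r^m` over `ℤ[x]`: `a_k = binom(e,k)·(2X - 1)^{e-k}` (`0 < k`),
`a_0 = (2X - 1)^e - (X - X²)^m`. [cite: MochizukiGenEll2010, Thm 2.1 proof p.11] -/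
private theorem ySum_natDegree {e m : ℕ} (hem : e + 3 = 2 * m) (k : ℕ) :
    ((fun k : ℕ => if k = 0 then ((2 * X - 1) ^ e - (X - X ^ 2) ^ m : ℤ[X])
      else C (e.choose k : ℤ) * (2 * X - 1) ^ (e - k)) k).natDegree ≤ (if k = 0 then 2 * m else e - k) ∧
    ((fun k : ℕ => if k = 0 then ((2 * X - 1) ^ e - (X - X ^ 2) ^ m : ℤ[X])
      else C (e.choose k : ℤ) * (2 * X - 1) ^ (e - k)) 0).natDegree = 2 * m := by
  have h2X : (2 * X - 1 : ℤ[X]).natDegree ≤ 1 := by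
    refine (natDegree_sub_le _ _).trans ?_
    simp only [natDegree_one, zero_le, sup_of_le_left]
    calc (2 * X : ℤ[X]).natDegree ≤ (2 : ℤ[X]).natDegree + (X : ℤ[X]).natDegree := natDegree_mul_le
      _ = 1 := by simp
  have hpow : ∀ n : ℕ, ((2 * X - 1 : ℤ[X]) ^ n).natDegree ≤ n := fun n =>
    (natDegree_pow_le).trans (by simpa using Nat.mul_le_mul_left n h2X)
  have hXX : (X - X ^ 2 : ℤ[X]).natDegree = 2 := by
    rw [natDegree_sub_eq_right_of_natDegree_lt] <;> simp
  have hXXm : ((X - X ^ 2 : ℤ[X]) ^ m).natDegree = 2 * m := by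
    rw [natDegree_pow, hXX, mul_comm]
  have he2m : e < 2 * m := by omega
  have ha0 : (((2 * X - 1) ^ e - (X - X ^ 2) ^ m : ℤ[X])).natDegree = 2 * m := by
    rw [natDegree_sub_eq_right_of_natDegree_lt, hXXm]
    rw [hXXm]; exact (hpow e).trans_lt he2m
  refine ⟨?_, by simpa using ha0⟩
  by_cases hk0 : k = 0
  · subst hk0; simp only [↓reduceIte]; exact ha0.le
  · simp only [hk0, ↓reduceIte]
    exact (natDegree_C_mul_le _ _).trans (hpow _)

/-- The weighted relation for `y = (1 - 2x) + r^m` (`r^e = x(1-x)`, `e + 3 = 2m`):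
`y^e + Σ_{k<e} a_k(x) y^k = 0`, i.e. `(y - (1-2x))^e = (x(1-x))^m`. [cite: MochizukiGenEll2010, Thm 2.1 proof p.11] -/
private theorem ySum_rel {K : Type*} [Field K] {e m : ℕ} (he : 0 < e) {x r y : K}
    (hr : r ^ e = x * (1 - x)) (hy : y = (1 - 2 * x) + r ^ m) :
    y ^ e + ∑ k ∈ range e, aeval x ((fun k : ℕ => if k = 0 then ((2 * X - 1) ^ e - (X - X ^ 2) ^ m : ℤ[X])
      else C (e.choose k : ℤ) * (2 * X - 1) ^ (e - k)) k) * y ^ k = 0 := by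
  -- the binomial expansion of `(y + (2x - 1))^e = (r^m)^e = (x(1-x))^m`
  have hbin : (y + (2 * x - 1)) ^ e =
      ∑ k ∈ range (e + 1), y ^ k * (2 * x - 1) ^ (e - k) * (e.choose k : K) := add_pow _ _ _
  have hval : (y + (2 * x - 1)) ^ e = (x * (1 - x)) ^ m := by
    rw [show y + (2 * x - 1) = r ^ m by rw [hy]; ring, ← pow_mul, mul_comm, pow_mul, hr]
  -- evaluate the coefficient polynomials
  have hev : ∀ k ∈ range e, aeval x ((fun k : ℕ => if k = 0 then ((2 * X - 1) ^ e - (X - X ^ 2) ^ m : ℤ[X])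
      else C (e.choose k : ℤ) * (2 * X - 1) ^ (e - k)) k) * y ^ k =
      y ^ k * (2 * x - 1) ^ (e - k) * (e.choose k : K) - (if k = 0 then (x - x ^ 2) ^ m else 0) := by
    intro k _
    by_cases hk0 : k = 0
    · subst hk0
      simp only [↓reduceIte, map_sub, map_pow, map_mul, aeval_X, map_one, pow_zero,
        Nat.sub_zero, Nat.choose_zero_right, Nat.cast_one, map_ofNat]
      ring
    · simp only [hk0, ↓reduceIte, map_mul, map_pow, map_sub, aeval_X, map_one, map_natCast, sub_zero,
        map_ofNat]
      ring
  rw [Finset.sum_congr rfl hev, Finset.sum_sub_distrib, Finset.sum_ite_eq' (range e) 0,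
    if_pos (mem_range.mpr he)]
  -- reassemble the binomial sum
  have hsplit : ∑ k ∈ range (e + 1), y ^ k * (2 * x - 1) ^ (e - k) * (e.choose k : K) =
      (∑ k ∈ range e, y ^ k * (2 * x - 1) ^ (e - k) * (e.choose k : K)) + y ^ e := by
    rw [Finset.sum_range_succ, Nat.sub_self, pow_zero, mul_one, Nat.choose_self, Nat.cast_one, mul_one]
  have key : y ^ e + (∑ k ∈ range e, y ^ k * (2 * x - 1) ^ (e - k) * (e.choose k : K)) =
      (x * (1 - x)) ^ m := by rw [← hval, hbin, hsplit, add_comm]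
  calc y ^ e + ((∑ k ∈ range e, y ^ k * (2 * x - 1) ^ (e - k) * (e.choose k : K)) - (x - x ^ 2) ^ m)
      = (y ^ e + ∑ k ∈ range e, y ^ k * (2 * x - 1) ^ (e - k) * (e.choose k : K)) - (x - x ^ 2) ^ m := by
        ring
    _ = 0 := by rw [key]; ring

/-- **`r^e = x(1-x)`, `e + 3 = 2m`, `y = (1 - 2x) + r^m` ⟹ `|e·h(y) − (e+3)·h(x)| ≤ C·[K:ℚ]`**
for every number field `K` and `x, r ∈ K`, with `C` depending only on `e ≥ 1`: the function
`y = s + r^m` on `D_e` (pole of order `e + 3` at the point at infinity only) has Weil height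
`((e+3)/e)·h(x) + O(1)` — [GenEll] Prop. 1.4 (i) for `y, x : D_e → ℙ¹`, here from the weighted
minimal relation `(y - s)^e - (x - x²)^m = 0`, weights `(wt x, wt y) = (e, e+3)`.
[cite: MochizukiGenEll2010, Prop 1.4 (i) p.6] -/
theorem exists_abs_logHeight₁_ySum_sub_le {e m : ℕ} (he : 0 < e) (hem : e + 3 = 2 * m) :
    ∃ C : ℝ, ∀ (K : Type) [Field K] [NumberField K] (x r : K), r ^ e = x * (1 - x) →
      |(e : ℝ) * logHeight₁ ((1 - 2 * x) + r ^ m) - (e + 3) * logHeight₁ x| ≤ C * Module.finrank ℚ K := by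
  set a : ℕ → ℤ[X] := fun k => if k = 0 then ((2 * X - 1) ^ e - (X - X ^ 2) ^ m : ℤ[X])
      else C (e.choose k : ℤ) * (2 * X - 1) ^ (e - k) with ha
  have hd : ∀ k < e, e * (a k).natDegree ≤ (e + 3) * (e - k) := by
    intro k hk
    obtain ⟨h1, -⟩ := ySum_natDegree (e := e) hem k
    rw [ha]
    by_cases hk0 : k = 0
    · subst hk0
      simp only [↓reduceIte] at h1 ⊢
      calc e * (((2 * X - 1) ^ e - (X - X ^ 2) ^ m : ℤ[X])).natDegree ≤ e * (2 * m) :=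
            Nat.mul_le_mul_left e h1
        _ = (e + 3) * (e - 0) := by rw [← hem, Nat.sub_zero, mul_comm]
    · simp only [hk0, ↓reduceIte] at h1 ⊢
      calc e * (C (e.choose k : ℤ) * (2 * X - 1) ^ (e - k)).natDegree ≤ e * (e - k) :=
            Nat.mul_le_mul_left e h1
        _ ≤ (e + 3) * (e - k) := Nat.mul_le_mul_right _ (by omega)
  have h0 : e * (a 0).natDegree = (e + 3) * e := by
    rw [ha, (ySum_natDegree (e := e) hem 0).2, ← hem, mul_comm]
  obtain ⟨C, hC⟩ := WeightedRoot.exists_abs_sub_le_of_weighted he he a hd h0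
  refine ⟨C, fun K _ _ x r hr => ?_⟩
  have h := hC K ((1 - 2 * x) + r ^ m) x (ySum_rel he hr rfl)
  simpa only [Nat.cast_add, Nat.cast_ofNat] using h

end Superelliptic

end Literature.NumberTheory.DiophantineGeometry

end
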